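import Mathlib

/-!
# Spread-cover tools for the property-2 substitutes of crux `RegularResolutionRung` (stmt-PneNP-9818)

cdisprove seat `refuter-cdisprove-stmt-PneNP-9818-g3-0`, cycle 2 (2026-08-16). Two small, line-independent
facts about statements of the shape used by `drc-selfrich-core` generation 2 (`stub_fractional` = FRAC₂) and
recommended for `sound-path-bottleneck` (see `Cruxes/RegularResolutionRung/StubBiDenseTrapSparseRefutation.md`):
"the traps admit a cover `𝓒` with `Σ_{C∈𝓒} θ^{|C|}` small".

* `cover_cost_ge_of_spread` — the LP-duality direction a REFUTER must feed: a probability weighting `μ` of the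
  traps that is `θ`-spread relative to `D` (every candidate cover element `C` is contained in traps of total
  mass `≤ θ^{|C|}/D`) forces every cover to cost `≥ D`. So refuting a spread-cover property = exhibiting a
  `θ`-spread trap measure (Park–Pham language), and conversely aligned junk pools (`< M` vertices per context,
  forced by lower bi-density) never give one: the uniform measure on a transversal family `∏ U_i` has
  `μ(⊇ C) = ∏_{i ∈ C} |U_i|^{-1} ≥ M^{-|C|}`.
* `frac2_trivial` — a spread-cover statement whose demand is `≥ 1` is vacuous (`𝓒 = {∅}`), which is why FRAC₂
  carries no lower bound on the trap threshold `q'`: below `q' ≈ M log₂⁴ n` it says nothing.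
-/

namespace Summit.PneNP.PneNP.Theorems.RegularResolutionRung.Negative

/-- LP-duality direction for spread-cover statements (FRAC₂-type): if the traps `𝓣` carry weights
`μ ≥ 0` of total mass `1` such that, for every candidate cover element `C ∈ 𝓒`, the traps containing
`C` have mass `≤ θ^{|C|}/D`, then any `𝓒` covering `𝓣` (every trap contains a member of `𝓒`) costs
`Σ_{C∈𝓒} θ^{|C|} ≥ D`. (A refutation of a spread-cover property = exhibiting such a `θ`-spread `μ`.) -/
theorem cover_cost_ge_of_spread {V : Type*} [DecidableEq V] (𝓣 𝓒 : Finset (Finset V))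
    (μ : Finset V → ℝ) (θ D : ℝ) (hD : 0 < D)
    (hμ0 : ∀ B ∈ 𝓣, 0 ≤ μ B) (hμ1 : 𝓣.sum μ = 1)
    (hcover : ∀ B ∈ 𝓣, ∃ C ∈ 𝓒, C ⊆ B)
    (hspread : ∀ C ∈ 𝓒, (𝓣.filter fun B => C ⊆ B).sum μ ≤ θ ^ C.card / D) :
    D ≤ 𝓒.sum fun C => θ ^ C.card := by
  -- 1 = Σ_B μ B ≤ Σ_B Σ_{C ∈ 𝓒, C ⊆ B} μ B = Σ_C Σ_{B ⊇ C} μ B ≤ Σ_C θ^|C| / D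
  have h1 : (1 : ℝ) ≤ 𝓣.sum fun B => (𝓒.filter fun C => C ⊆ B).sum fun _ => μ B := by
    rw [← hμ1]
    refine Finset.sum_le_sum fun B hB => ?_
    obtain ⟨C, hC, hCB⟩ := hcover B hB
    have hmem : C ∈ 𝓒.filter fun C => C ⊆ B := Finset.mem_filter.2 ⟨hC, hCB⟩
    calc μ B = ({C} : Finset (Finset V)).sum fun _ => μ B := by simp
      _ ≤ (𝓒.filter fun C => C ⊆ B).sum fun _ => μ B :=
        Finset.sum_le_sum_of_subset_of_nonneg (Finset.singleton_subset_iff.2 hmem)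
          (fun _ _ _ => hμ0 B hB)
  have h2 : (𝓣.sum fun B => (𝓒.filter fun C => C ⊆ B).sum fun _ => μ B)
      = 𝓒.sum fun C => (𝓣.filter fun B => C ⊆ B).sum μ := by
    rw [Finset.sum_comm' (t' := 𝓒) (s' := fun C => 𝓣.filter fun B => C ⊆ B)]
    intro B C
    simp only [Finset.mem_filter]
    tauto
  have h3 : (𝓒.sum fun C => (𝓣.filter fun B => C ⊆ B).sum μ) ≤ 𝓒.sum fun C => θ ^ C.card / D :=
    Finset.sum_le_sum fun C hC => hspread C hC
  have h4 : (𝓒.sum fun C => θ ^ C.card / D) = (𝓒.sum fun C => θ ^ C.card) / D := by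
    rw [Finset.sum_div]
  have h5 : (1 : ℝ) ≤ (𝓒.sum fun C => θ ^ C.card) / D := by
    rw [← h4]; exact h1.trans (h2 ▸ h3)
  rwa [le_div_iff₀ hD, one_mul] at h5

/-- The spread-cover property FRAC₂ is VACUOUS in the regime where its demand is `≥ 1`: the
one-element family `{∅}` covers every trap at cost `1`. -/
theorem frac2_trivial {V : Type*} [DecidableEq V] (Trap : Finset V → Prop) (θ X : ℝ) (r : ℕ)
    (hX : 1 ≤ X) :
    ∃ 𝓒 : Finset (Finset V), (∀ B, Trap B → ∃ C ∈ 𝓒, C ⊆ B) ∧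
      (𝓒.sum fun C => θ ^ C.card) ^ 4 ≤ X ^ r :=
  ⟨{∅}, fun B _ => ⟨∅, Finset.mem_singleton_self _, Finset.empty_subset _⟩, by
    simpa using one_le_pow₀ hX⟩


end Summit.PneNP.PneNP.Theorems.RegularResolutionRung.Negative
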